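import Summits.Ventures.DiscreteObjects.Hadamard.ConferenceGraph333PrimeSpectrum
import Summits.Ventures.DiscreteObjects.Hadamard.ConferenceGraph333Involution
import Summits.Ventures.DiscreteObjects.Hadamard.PermPowFixedPoints

/-!
# Automorphisms of order `p·q` of srg(333,166,82,83): composite-order exclusions (kernel)

Framing: lottery ticket; floor = certified bounds/negative ranges.  Cell pub-namedobj (venture DiscreteObjects),
target (H) = `H(668)`, hadamard gen 28.  For an automorphism `τ` with `τ^(pq) = 1`, `τ^p ≠ 1`, `τ^q ≠ 1` (`p < q`
primes) the prime census (`ConferenceGraph333PrimeSpectrum.primeOrder_census`, applied to `τ^q` and `τ^p`;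
`ConferenceGraph333Involution` for `p = 2`) combines with `#Fix(τ^p) ≡ #Fix(τ) (mod p)`, `#Fix(τ^q) ≡ #Fix(τ) (mod q)`
(`PermPowFixedPoints`) and `Fix(τ) ⊆ Fix(τ^p) ∩ Fix(τ^q)`:
* **`aut_two_primes_facts`** — the packaged arithmetic facts (`a = #Fix τ`, `b = #Fix τ^p`, `c = #Fix τ^q`);
* **`no_aut_order_111/123/249/185/85/115/119/143`** — NO automorphism of `srg(333,166,82,83)` has order
  `111 = 3·37`, `123 = 3·41`, `249 = 3·83`, `185 = 5·37`, `85 = 5·17`, `115 = 5·23`, `119 = 7·17`, `143 = 11·13`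
  (e.g. `111`: `τ³` of order `37` is fixed-point-free, so `37 ∣ #Fix(τ^37)`, but `#Fix(τ^37) ∈ {3, 9, …, 81}`).
  Script level (same facts, exact enumeration; seat notes): the surviving products of two distinct primes are exactly
  `6, 10, 14, 15, 21, 22, 26, 33, 34, 35, 39, 46, 51, 55, 65, 69, 74, 77, 82, 91, 161, 166`; in particular the element orders
  divisible by `37` are at most `37, 74`, by `83`: `83, 166`, by `41`: `41, 82`.
Structure of a hypothetical object only.  No `sorry`, no new definitions.
-/

namespace Summit.Ventures.DiscreteObjects.Hadamard

open Finset

section composite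
variable {V : Type*} [Fintype V] [DecidableEq V]

/-- **Arithmetic facts for an automorphism of order dividing `p·q`** (`p < q` primes, `τ^p ≠ 1 ≠ τ^q`). -/
theorem aut_two_primes_facts (hV : Fintype.card V = 333) (A : Matrix V V ℤ)
    (h01 : ∀ x y, A x y = 0 ∨ A x y = 1) (hsymm : ∀ x y, A y x = A x y) (hdiag : ∀ x, A x x = 0)
    (hk : ∀ x, ∑ y, A x y = 166) (hsrg : ∀ x y, ∑ z, A x z * A z y = 83 * (1 + (if x = y then 1 else 0)) - A x y)
    {p q : ℕ} (hp : p.Prime) (hq : q.Prime) (hpq : p < q) (τ : Equiv.Perm V) (hτ : τ ^ (p * q) = 1)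
    (hτp : τ ^ p ≠ 1) (hτq : τ ^ q ≠ 1) (hA : ∀ x y, A (τ x) (τ y) = A x y) :
    ∃ a b c mb : ℕ, a ≤ b ∧ a ≤ c ∧ p ∣ b - a ∧ q ∣ c - a ∧
      (b + q * mb = 333 ∧ 1 ≤ mb ∧ q * b + mb + q ≤ 334 ∧ (q % 4 = 3 → 2 ∣ mb ∧ q * b + mb + q + 4 ≤ 334)) ∧
      (p = 2 → c % 4 = 1) ∧
      (p ≠ 2 → ∃ mc : ℕ, c + p * mc = 333 ∧ 1 ≤ mc ∧ p * c + mc + p ≤ 334 ∧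
        (p % 4 = 3 → 2 ∣ mc ∧ p * c + mc + p + 4 ≤ 334)) := by
  have hAk : ∀ (k : ℕ) x y, A ((τ ^ k) x) ((τ ^ k) y) = A x y := by
    intro k; induction k with
    | zero => intro x y; simp
    | succ k ih => intro x y; rw [pow_succ', Equiv.Perm.mul_apply, Equiv.Perm.mul_apply, hA, ih]
  have hσp : (τ ^ q) ^ p = 1 := by rw [← pow_mul, mul_comm, hτ]
  have hσq : (τ ^ p) ^ q = 1 := by rw [← pow_mul, hτ]
  have hq2 : q ≠ 2 := by have := hp.two_le; omega
  obtain ⟨b, mb, hbdef, hb⟩ := primeOrder_census hV A h01 hsymm hdiag hk hsrg hq hq2 (τ ^ p) hσq hτp (hAk p)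
  haveI : Fact p.Prime := ⟨hp⟩
  haveI hqF : Fact q.Prime := ⟨hq⟩
  have hab := card_fixed_le_card_fixed_pow τ p
  have hac := card_fixed_le_card_fixed_pow τ q
  have hdb := (Nat.modEq_iff_dvd' hab).mp (card_fixed_pow_prime_modEq τ p).symm
  have hdc := (Nat.modEq_iff_dvd' hac).mp (card_fixed_pow_prime_modEq τ q).symm
  refine ⟨(univ.filter fun x => τ x = x).card, b, (univ.filter fun x => (τ ^ q) x = x).card, mb,
    hbdef ▸ hab, hac, hbdef ▸ hdb, hdc, hb, fun hp2 => ?_, fun hp2 => ?_⟩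
  · subst hp2
    refine involution_fixedPoints_mod_four hV A h01 hsymm hdiag hk hsrg (τ ^ q) (fun x => ?_) (hAk q)
    have := congrArg (fun g : Equiv.Perm V => g x) hσp
    simpa [pow_two] using this
  · obtain ⟨c, mc, hcdef, hc⟩ := primeOrder_census hV A h01 hsymm hdiag hk hsrg hp hp2 (τ ^ q) hσp hτq (hAk q)
    exact ⟨mc, hcdef ▸ hc⟩

/-- **No automorphism of order `111 = 3·37`.** -/
theorem no_aut_order_111 (hV : Fintype.card V = 333) (A : Matrix V V ℤ)
    (h01 : ∀ x y, A x y = 0 ∨ A x y = 1) (hsymm : ∀ x y, A y x = A x y) (hdiag : ∀ x, A x x = 0)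
    (hk : ∀ x, ∑ y, A x y = 166) (hsrg : ∀ x y, ∑ z, A x z * A z y = 83 * (1 + (if x = y then 1 else 0)) - A x y)
    (τ : Equiv.Perm V) (hτ : τ ^ (3 * 37) = 1) (hτp : τ ^ 3 ≠ 1) (hτq : τ ^ 37 ≠ 1)
    (hA : ∀ x y, A (τ x) (τ y) = A x y) : False := by
  obtain ⟨a, b, c, mb, hab, hac, hdb, hdc, ⟨hb1, hb2, hb3, hb4⟩, -, hC⟩ :=
    aut_two_primes_facts hV A h01 hsymm hdiag hk hsrg (by norm_num) (by norm_num) (by norm_num) τ hτ hτp hτq hA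
  obtain ⟨mc, hc1, hc2, hc3, hc4⟩ := hC (by norm_num)
  obtain ⟨kb, hkb⟩ := hdb
  obtain ⟨kc, hkc⟩ := hdc
  clear hb4
  obtain ⟨⟨jc, hjc⟩, hc5⟩ := hc4 (by norm_num)
  omega

/-- **No automorphism of order `123 = 3·41`.** -/
theorem no_aut_order_123 (hV : Fintype.card V = 333) (A : Matrix V V ℤ)
    (h01 : ∀ x y, A x y = 0 ∨ A x y = 1) (hsymm : ∀ x y, A y x = A x y) (hdiag : ∀ x, A x x = 0)
    (hk : ∀ x, ∑ y, A x y = 166) (hsrg : ∀ x y, ∑ z, A x z * A z y = 83 * (1 + (if x = y then 1 else 0)) - A x y)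
    (τ : Equiv.Perm V) (hτ : τ ^ (3 * 41) = 1) (hτp : τ ^ 3 ≠ 1) (hτq : τ ^ 41 ≠ 1)
    (hA : ∀ x y, A (τ x) (τ y) = A x y) : False := by
  obtain ⟨a, b, c, mb, hab, hac, hdb, hdc, ⟨hb1, hb2, hb3, hb4⟩, -, hC⟩ :=
    aut_two_primes_facts hV A h01 hsymm hdiag hk hsrg (by norm_num) (by norm_num) (by norm_num) τ hτ hτp hτq hA
  obtain ⟨mc, hc1, hc2, hc3, hc4⟩ := hC (by norm_num)
  obtain ⟨kb, hkb⟩ := hdb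
  obtain ⟨kc, hkc⟩ := hdc
  clear hb4
  obtain ⟨⟨jc, hjc⟩, hc5⟩ := hc4 (by norm_num)
  omega

/-- **No automorphism of order `249 = 3·83`.** -/
theorem no_aut_order_249 (hV : Fintype.card V = 333) (A : Matrix V V ℤ)
    (h01 : ∀ x y, A x y = 0 ∨ A x y = 1) (hsymm : ∀ x y, A y x = A x y) (hdiag : ∀ x, A x x = 0)
    (hk : ∀ x, ∑ y, A x y = 166) (hsrg : ∀ x y, ∑ z, A x z * A z y = 83 * (1 + (if x = y then 1 else 0)) - A x y)
    (τ : Equiv.Perm V) (hτ : τ ^ (3 * 83) = 1) (hτp : τ ^ 3 ≠ 1) (hτq : τ ^ 83 ≠ 1)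
    (hA : ∀ x y, A (τ x) (τ y) = A x y) : False := by
  obtain ⟨a, b, c, mb, hab, hac, hdb, hdc, ⟨hb1, hb2, hb3, hb4⟩, -, hC⟩ :=
    aut_two_primes_facts hV A h01 hsymm hdiag hk hsrg (by norm_num) (by norm_num) (by norm_num) τ hτ hτp hτq hA
  obtain ⟨mc, hc1, hc2, hc3, hc4⟩ := hC (by norm_num)
  obtain ⟨kb, hkb⟩ := hdb
  obtain ⟨kc, hkc⟩ := hdc
  obtain ⟨⟨jb, hjb⟩, hb5⟩ := hb4 (by norm_num)
  obtain ⟨⟨jc, hjc⟩, hc5⟩ := hc4 (by norm_num)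
  omega

/-- **No automorphism of order `185 = 5·37`.** -/
theorem no_aut_order_185 (hV : Fintype.card V = 333) (A : Matrix V V ℤ)
    (h01 : ∀ x y, A x y = 0 ∨ A x y = 1) (hsymm : ∀ x y, A y x = A x y) (hdiag : ∀ x, A x x = 0)
    (hk : ∀ x, ∑ y, A x y = 166) (hsrg : ∀ x y, ∑ z, A x z * A z y = 83 * (1 + (if x = y then 1 else 0)) - A x y)
    (τ : Equiv.Perm V) (hτ : τ ^ (5 * 37) = 1) (hτp : τ ^ 5 ≠ 1) (hτq : τ ^ 37 ≠ 1)
    (hA : ∀ x y, A (τ x) (τ y) = A x y) : False := by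
  obtain ⟨a, b, c, mb, hab, hac, hdb, hdc, ⟨hb1, hb2, hb3, hb4⟩, -, hC⟩ :=
    aut_two_primes_facts hV A h01 hsymm hdiag hk hsrg (by norm_num) (by norm_num) (by norm_num) τ hτ hτp hτq hA
  obtain ⟨mc, hc1, hc2, hc3, hc4⟩ := hC (by norm_num)
  obtain ⟨kb, hkb⟩ := hdb
  obtain ⟨kc, hkc⟩ := hdc
  clear hb4
  clear hc4
  omega

/-- **No automorphism of order `85 = 5·17`.** -/
theorem no_aut_order_85 (hV : Fintype.card V = 333) (A : Matrix V V ℤ)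
    (h01 : ∀ x y, A x y = 0 ∨ A x y = 1) (hsymm : ∀ x y, A y x = A x y) (hdiag : ∀ x, A x x = 0)
    (hk : ∀ x, ∑ y, A x y = 166) (hsrg : ∀ x y, ∑ z, A x z * A z y = 83 * (1 + (if x = y then 1 else 0)) - A x y)
    (τ : Equiv.Perm V) (hτ : τ ^ (5 * 17) = 1) (hτp : τ ^ 5 ≠ 1) (hτq : τ ^ 17 ≠ 1)
    (hA : ∀ x y, A (τ x) (τ y) = A x y) : False := by
  obtain ⟨a, b, c, mb, hab, hac, hdb, hdc, ⟨hb1, hb2, hb3, hb4⟩, -, hC⟩ :=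
    aut_two_primes_facts hV A h01 hsymm hdiag hk hsrg (by norm_num) (by norm_num) (by norm_num) τ hτ hτp hτq hA
  obtain ⟨mc, hc1, hc2, hc3, hc4⟩ := hC (by norm_num)
  obtain ⟨kb, hkb⟩ := hdb
  obtain ⟨kc, hkc⟩ := hdc
  clear hb4
  clear hc4
  omega

/-- **No automorphism of order `115 = 5·23`.** -/
theorem no_aut_order_115 (hV : Fintype.card V = 333) (A : Matrix V V ℤ)
    (h01 : ∀ x y, A x y = 0 ∨ A x y = 1) (hsymm : ∀ x y, A y x = A x y) (hdiag : ∀ x, A x x = 0)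
    (hk : ∀ x, ∑ y, A x y = 166) (hsrg : ∀ x y, ∑ z, A x z * A z y = 83 * (1 + (if x = y then 1 else 0)) - A x y)
    (τ : Equiv.Perm V) (hτ : τ ^ (5 * 23) = 1) (hτp : τ ^ 5 ≠ 1) (hτq : τ ^ 23 ≠ 1)
    (hA : ∀ x y, A (τ x) (τ y) = A x y) : False := by
  obtain ⟨a, b, c, mb, hab, hac, hdb, hdc, ⟨hb1, hb2, hb3, hb4⟩, -, hC⟩ :=
    aut_two_primes_facts hV A h01 hsymm hdiag hk hsrg (by norm_num) (by norm_num) (by norm_num) τ hτ hτp hτq hA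
  obtain ⟨mc, hc1, hc2, hc3, hc4⟩ := hC (by norm_num)
  obtain ⟨kb, hkb⟩ := hdb
  obtain ⟨kc, hkc⟩ := hdc
  obtain ⟨⟨jb, hjb⟩, hb5⟩ := hb4 (by norm_num)
  clear hc4
  omega

/-- **No automorphism of order `119 = 7·17`.** -/
theorem no_aut_order_119 (hV : Fintype.card V = 333) (A : Matrix V V ℤ)
    (h01 : ∀ x y, A x y = 0 ∨ A x y = 1) (hsymm : ∀ x y, A y x = A x y) (hdiag : ∀ x, A x x = 0)
    (hk : ∀ x, ∑ y, A x y = 166) (hsrg : ∀ x y, ∑ z, A x z * A z y = 83 * (1 + (if x = y then 1 else 0)) - A x y)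
    (τ : Equiv.Perm V) (hτ : τ ^ (7 * 17) = 1) (hτp : τ ^ 7 ≠ 1) (hτq : τ ^ 17 ≠ 1)
    (hA : ∀ x y, A (τ x) (τ y) = A x y) : False := by
  obtain ⟨a, b, c, mb, hab, hac, hdb, hdc, ⟨hb1, hb2, hb3, hb4⟩, -, hC⟩ :=
    aut_two_primes_facts hV A h01 hsymm hdiag hk hsrg (by norm_num) (by norm_num) (by norm_num) τ hτ hτp hτq hA
  obtain ⟨mc, hc1, hc2, hc3, hc4⟩ := hC (by norm_num)
  obtain ⟨kb, hkb⟩ := hdb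
  obtain ⟨kc, hkc⟩ := hdc
  clear hb4
  obtain ⟨⟨jc, hjc⟩, hc5⟩ := hc4 (by norm_num)
  omega

/-- **No automorphism of order `143 = 11·13`.** -/
theorem no_aut_order_143 (hV : Fintype.card V = 333) (A : Matrix V V ℤ)
    (h01 : ∀ x y, A x y = 0 ∨ A x y = 1) (hsymm : ∀ x y, A y x = A x y) (hdiag : ∀ x, A x x = 0)
    (hk : ∀ x, ∑ y, A x y = 166) (hsrg : ∀ x y, ∑ z, A x z * A z y = 83 * (1 + (if x = y then 1 else 0)) - A x y)
    (τ : Equiv.Perm V) (hτ : τ ^ (11 * 13) = 1) (hτp : τ ^ 11 ≠ 1) (hτq : τ ^ 13 ≠ 1)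
    (hA : ∀ x y, A (τ x) (τ y) = A x y) : False := by
  obtain ⟨a, b, c, mb, hab, hac, hdb, hdc, ⟨hb1, hb2, hb3, hb4⟩, -, hC⟩ :=
    aut_two_primes_facts hV A h01 hsymm hdiag hk hsrg (by norm_num) (by norm_num) (by norm_num) τ hτ hτp hτq hA
  obtain ⟨mc, hc1, hc2, hc3, hc4⟩ := hC (by norm_num)
  obtain ⟨kb, hkb⟩ := hdb
  obtain ⟨kc, hkc⟩ := hdc
  clear hb4
  obtain ⟨⟨jc, hjc⟩, hc5⟩ := hc4 (by norm_num)
  omega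

end composite

end Summit.Ventures.DiscreteObjects.Hadamard
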